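import Summits.AtomisticToContinuum.FouriersLaw.Theses.EmbeddedDrudeMourre
import Literature.MathematicalPhysics.KineticTheory.HarmonicChaosDecomposition
import HarnessLib

/-!
# Stub KAlg `stub_harmonicPencilAlgebra`, part 1: the Green identity, `w_{Lf} = −iω w_f`,
skewness of the thermal covariance
(line `gram-pencil-harmonic-chaos`, crux `EmbeddedDrudeMourre.DrudeDissolution`,
item stmt-AtomisticToContinuum-12593; `--supports` file, closes nothing)

WHAT. For the harmonic pinned chain with dispersion `ω(k)² = ω₂ + 2 − 2cos k` (`ω₂ > 0`) and the
lattice Klein–Gordon generator on coefficient pairs `f = (f^q, f^p) : TestFn`,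
`L f = (−(ω₂+2) f^p + f^p(·−1) + f^p(·+1), f^q)` (written inline as
`((-(ω₂ + 2)) • f.2 + mapDomain (· + 1) f.2 + mapDomain (· − 1) f.2, f.1)`):

* the Green identity `(ω₂+2) G(z) − G(z+1) − G(z−1) = [z = 0]` for the lattice Green function
  `G = greenFn ω₂` (`greenFn_harmonic_identity`);
* conjunct (d) of the stub: `thermalCov ω₂ T (L f) g = −thermalCov ω₂ T f (L g)` (`thermalCov_kg_skew`);
* conjunct (c) of the stub: `thermalWave ω₂ T (L f) k = −iω(k) · thermalWave ω₂ T f k`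
  (`thermalWave_kg`).

HOW. `e^{ik} + e^{−ik} = 2cos k` on `𝕋 = ℝ/2πℤ`, so `(ω₂+2)Re e^{izk} − Re e^{i(z+1)k} − Re e^{i(z−1)k}
= ω(k)² Re e^{izk}` and the Green combination integrates `Re e^{izk}` against the Haar probability
measure, which is `[z = 0]` (`fourier_add_half_inv_index`). Parts (c), (d) are then finite `Finsupp.sum`
manipulations (`sum_add_index'`, `sum_smul_index`, `sum_mapDomain_index`).
-/

noncomputable section

namespace Summit.AtomisticToContinuum.FouriersLaw.Theorems.DrudeDissolution.GramPencilHarmonicChaos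

open MeasureTheory Filter Set Function Topology
open scoped InnerProductSpace ENNReal ComplexConjugate
open Literature.MathematicalPhysics.KineticTheory
open Literature.MathematicalPhysics.KineticTheory.HeatConduction
open HarmonicChaos
open PinnedChainKinetic (𝕋 μ𝕋 cosT dispersion)
open scoped Literature.MathematicalPhysics.KineticTheory.HeatConduction.PinnedChainKinetic

/-! ## Fourier monomials on the Brillouin circle -/

/-- `e^{ik} + e^{-ik} = 2cos k` on `𝕋 = ℝ/2πℤ`. [folklore] -/
theorem fourier_one_add_fourier_neg_one (k : 𝕋) :
    (fourier 1 k : ℂ) + fourier (-1) k = 2 * (cosT k : ℂ) := by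
  induction k using QuotientAddGroup.induction_on with
  | H x => ?_
  rw [fourier_coe_apply, fourier_coe_apply, PinnedChainKinetic.cosT_coe, Complex.ofReal_cos,
    Complex.two_cos]
  have hπ : (Real.pi : ℂ) ≠ 0 := Complex.ofReal_ne_zero.2 Real.pi_ne_zero
  have e1 : (2 * (Real.pi : ℂ) * Complex.I * ((1 : ℤ) : ℂ) * (x : ℂ) / ((2 * Real.pi : ℝ) : ℂ)) =
      (x : ℂ) * Complex.I := by
    push_cast
    field_simp
  have e2 : (2 * (Real.pi : ℂ) * Complex.I * ((-1 : ℤ) : ℂ) * (x : ℂ) / ((2 * Real.pi : ℝ) : ℂ)) =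
      -(x : ℂ) * Complex.I := by
    push_cast
    field_simp
  rw [e1, e2]

/-- `∫ e^{izk} dμ𝕋 = [z = 0]` (Haar probability measure). [folklore] -/
theorem integral_fourier_haar (z : ℤ) :
    ∫ k : 𝕋, (fourier z k : ℂ) ∂μ𝕋 = if z = 0 then 1 else 0 := by
  split_ifs with hz
  · subst hz
    simp
  · exact integral_eq_zero_of_add_right_eq_neg (fourier_add_half_inv_index hz Real.two_pi_pos)

/-- `∫ Re e^{izk} dμ𝕋 = [z = 0]`. [folklore] -/
theorem integral_re_fourier_haar (z : ℤ) :
    ∫ k : 𝕋, (fourier z k : ℂ).re ∂μ𝕋 = if z = 0 then 1 else 0 := by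
  have hint : Integrable (fun k : 𝕋 => (fourier z k : ℂ)) μ𝕋 :=
    (fourier z).continuous.integrable_of_hasCompactSupport (HasCompactSupport.of_compactSpace _)
  have h := integral_re hint
  simp only [RCLike.re_to_complex] at h
  rw [h, integral_fourier_haar]
  split_ifs <;> simp

/-! ## The Green identity -/

/-- `ω(k)² = ω₂ + 2 − 2cos k`. [folklore] -/
theorem dispersion_sq_eq {ω₂ : ℝ} (hω : 0 ≤ ω₂) (k : 𝕋) :
    dispersion ω₂ k ^ 2 = ω₂ + 2 - 2 * cosT k := by
  unfold PinnedChainKinetic.dispersion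
  have h1 : cosT k ≤ 1 := (abs_le.1 (PinnedChainKinetic.abs_cosT_le_one k)).2
  rw [Real.sq_sqrt (by linarith)]
  ring

/-- The integrand of the lattice Green function is integrable (`ω₂ > 0`). [folklore] -/
theorem integrable_greenIntegrand {ω₂ : ℝ} (hω : 0 < ω₂) (z : ℤ) :
    Integrable (fun k : 𝕋 => (fourier z k : ℂ).re / dispersion ω₂ k ^ 2) μ𝕋 := by
  have hc : Continuous (fun k : 𝕋 => (fourier z k : ℂ).re / dispersion ω₂ k ^ 2) :=
    (Complex.continuous_re.comp (fourier z).continuous).div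
      ((PinnedChainKinetic.continuous_dispersion ω₂).pow 2)
      (fun k => pow_ne_zero 2 (PinnedChainKinetic.dispersion_ne_zero hω k))
  exact hc.integrable_of_hasCompactSupport (HasCompactSupport.of_compactSpace _)

/-- Pointwise form of the Green identity:
`(ω₂+2)Re e^{izk}/ω² − Re e^{i(z+1)k}/ω² − Re e^{i(z−1)k}/ω² = Re e^{izk}`. [folklore] -/
theorem greenIntegrand_identity {ω₂ : ℝ} (hω : 0 < ω₂) (z : ℤ) (k : 𝕋) :
    (ω₂ + 2) * ((fourier z k : ℂ).re / dispersion ω₂ k ^ 2)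
        - (fourier (z + 1) k : ℂ).re / dispersion ω₂ k ^ 2
        - (fourier (z - 1) k : ℂ).re / dispersion ω₂ k ^ 2 = (fourier z k : ℂ).re := by
  have hsq := dispersion_sq_eq hω.le k
  have hne : dispersion ω₂ k ^ 2 ≠ 0 := pow_ne_zero 2 (PinnedChainKinetic.dispersion_ne_zero hω k)
  have hre : (fourier (z + 1) k : ℂ).re + (fourier (z - 1) k : ℂ).re =
      2 * cosT k * (fourier z k : ℂ).re := by
    rw [sub_eq_add_neg, fourier_add, fourier_add, ← Complex.add_re, ← mul_add,
      fourier_one_add_fourier_neg_one]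
    simp [Complex.mul_re]
    ring
  rw [show ∀ a b c : ℝ, a - b - c = a - (b + c) from fun a b c => by ring, ← add_div, hre]
  rw [hsq] at hne ⊢
  field_simp

/-- **The Green identity of the lattice Klein–Gordon operator**: `A G = δ₀` for
`A = (ω₂ + 2) − S − S⁻¹`, i.e. `(ω₂+2) G(z) − G(z+1) − G(z−1) = [z = 0]`, `G = greenFn ω₂`, `ω₂ > 0`.
[folklore] -/
theorem greenFn_harmonic_identity {ω₂ : ℝ} (hω : 0 < ω₂) (z : ℤ) :
    (ω₂ + 2) * greenFn ω₂ z - greenFn ω₂ (z + 1) - greenFn ω₂ (z - 1) = if z = 0 then 1 else 0 := by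
  have hA := (integrable_greenIntegrand hω z).const_mul (ω₂ + 2)
  have hB := integrable_greenIntegrand hω (z + 1)
  have hC := integrable_greenIntegrand hω (z - 1)
  have hAB : Integrable (fun k : 𝕋 => (ω₂ + 2) * ((fourier z k : ℂ).re / dispersion ω₂ k ^ 2)
      - (fourier (z + 1) k : ℂ).re / dispersion ω₂ k ^ 2) μ𝕋 := hA.sub hB
  have h := integral_congr_ae (ae_of_all μ𝕋 fun k => greenIntegrand_identity hω z k)
  rw [integral_sub hAB hC, integral_sub hA hB, integral_const_mul,
    integral_re_fourier_haar] at h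
  unfold greenFn
  exact h

/-- The Green identity in two-variable form: `−(ω₂+2)G(x−y) + G(x+1−y) + G(x−1−y) = −[x = y]`.
[folklore] -/
theorem greenFn_harmonic_identity₂ {ω₂ : ℝ} (hω : 0 < ω₂) (x y : ℤ) :
    -(ω₂ + 2) * greenFn ω₂ (x - y) + greenFn ω₂ (x + 1 - y) + greenFn ω₂ (x - 1 - y) =
      -(if x = y then 1 else 0) := by
  have h := greenFn_harmonic_identity hω (x - y)
  rw [show x + 1 - y = x - y + 1 by ring, show x - 1 - y = x - y - 1 by ring]
  by_cases hxy : x = y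
  · subst hxy
    simp only [sub_self, if_true] at h ⊢
    linarith
  · rw [if_neg (sub_ne_zero.2 hxy)] at h
    rw [if_neg hxy]
    linarith


/-! ## The lattice Klein–Gordon generator on coefficient pairs: `Finsupp.sum` bookkeeping -/

/-- Summing an additive weight `h` against `(L f)^q = −(ω₂+2) f^p + S f^p + S⁻¹ f^p`:
`Σ_x h(x, (Lf)^q_x) = Σ_x [h(x, −(ω₂+2) f^p_x) + h(x+1, f^p_x) + h(x−1, f^p_x)]`. [folklore] -/
theorem sum_kgFst {M : Type*} [AddCommMonoid M] (ω₂ : ℝ) (p : ℤ →₀ ℝ) (h : ℤ → ℝ → M)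
    (h0 : ∀ x, h x 0 = 0) (hadd : ∀ x a b, h x (a + b) = h x a + h x b) :
    ((-(ω₂ + 2)) • p + Finsupp.mapDomain (fun x : ℤ => x + 1) p +
        Finsupp.mapDomain (fun x : ℤ => x - 1) p).sum h =
      p.sum (fun x a => h x ((-(ω₂ + 2)) * a) + h (x + 1) a + h (x - 1) a) := by
  rw [Finsupp.sum_add_index' h0 hadd, Finsupp.sum_add_index' h0 hadd, Finsupp.sum_smul_index h0,
    Finsupp.sum_mapDomain_index h0 hadd, Finsupp.sum_mapDomain_index h0 hadd, ← Finsupp.sum_add,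
    ← Finsupp.sum_add]

/-- `Σ_y a g_y (−[x = y]) = −a g_x` as a `Finsupp.sum`. [folklore] -/
theorem finsupp_sum_mul_neg_ite (g : ℤ →₀ ℝ) (x : ℤ) (a : ℝ) :
    g.sum (fun y b => a * b * -(if x = y then (1 : ℝ) else 0)) = -(a * g x) := by
  classical
  have h1 : ∀ (y : ℤ) (b : ℝ), a * b * -(if x = y then (1 : ℝ) else 0) = if x = y then -(a * b) else 0 := by
    intro y b
    split_ifs <;> ring
  simp_rw [h1]
  rw [Finsupp.sum_ite_eq]
  split_ifs with hx
  · rfl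
  · rw [Finsupp.notMem_support_iff.1 hx]
    ring

/-! ## Conjunct (d): skewness of the thermal covariance under `L` -/

/-- Left reduced form: `C_T(Lf, g) = T (Σ_x f^q_x g^p_x − Σ_x f^p_x g^q_x)` (`ω₂ > 0`). [folklore] -/
theorem thermalCov_kg_left {ω₂ : ℝ} (hω : 0 < ω₂) (T : ℝ) (f g : TestFn) :
    thermalCov ω₂ T ((-(ω₂ + 2)) • f.2 + Finsupp.mapDomain (fun x : ℤ => x + 1) f.2 +
        Finsupp.mapDomain (fun x : ℤ => x - 1) f.2, f.1) g =
      T * ((f.1.sum fun x a => a * g.2 x) - f.2.sum fun x a => a * g.1 x) := by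
  unfold thermalCov
  congr 1
  have key : ∀ (x : ℤ) (a : ℝ),
      (g.1.sum fun y b => (-(ω₂ + 2)) * a * b * greenFn ω₂ (x - y)) +
        (g.1.sum fun y b => a * b * greenFn ω₂ (x + 1 - y)) +
        (g.1.sum fun y b => a * b * greenFn ω₂ (x - 1 - y)) = -(a * g.1 x) := by
    intro x a
    rw [← Finsupp.sum_add, ← Finsupp.sum_add, ← finsupp_sum_mul_neg_ite g.1 x a]
    refine Finsupp.sum_congr fun y _ => ?_
    rw [← greenFn_harmonic_identity₂ hω x y]
    ring
  rw [sum_kgFst ω₂ f.2 (fun x a => g.1.sum fun y b => a * b * greenFn ω₂ (x - y))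
    (fun x => by simp) (fun x a b => by simp only [add_mul, Finsupp.sum_add])]
  simp_rw [key]
  simp only [Finsupp.sum, Finset.sum_neg_distrib]
  ring

/-- Right reduced form: `C_T(f, Lg) = T (Σ_x f^p_x g^q_x − Σ_x f^q_x g^p_x)` (`ω₂ > 0`). [folklore] -/
theorem thermalCov_kg_right {ω₂ : ℝ} (hω : 0 < ω₂) (T : ℝ) (f g : TestFn) :
    thermalCov ω₂ T f ((-(ω₂ + 2)) • g.2 + Finsupp.mapDomain (fun x : ℤ => x + 1) g.2 +
        Finsupp.mapDomain (fun x : ℤ => x - 1) g.2, g.1) =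
      T * ((f.2.sum fun x a => a * g.1 x) - f.1.sum fun x a => a * g.2 x) := by
  unfold thermalCov
  congr 1
  have key : ∀ (x : ℤ) (a : ℝ),
      ((-(ω₂ + 2)) • g.2 + Finsupp.mapDomain (fun x : ℤ => x + 1) g.2 +
          Finsupp.mapDomain (fun x : ℤ => x - 1) g.2).sum (fun y b => a * b * greenFn ω₂ (x - y)) =
        -(a * g.2 x) := by
    intro x a
    rw [sum_kgFst ω₂ g.2 (fun y b => a * b * greenFn ω₂ (x - y)) (fun y => by ring)
      (fun y b₁ b₂ => by ring), ← finsupp_sum_mul_neg_ite g.2 x a]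
    refine Finsupp.sum_congr fun y _ => ?_
    rw [← greenFn_harmonic_identity₂ hω x y, show x - (y + 1) = x - 1 - y by ring,
      show x - (y - 1) = x + 1 - y by ring]
    ring
  simp_rw [key]
  simp only [Finsupp.sum, Finset.sum_neg_distrib]
  ring

/-- **Conjunct (d) of stub KAlg: the thermal covariance is `L`-skew**, `C_T(Lf, g) = −C_T(f, Lg)`
(`ω₂ > 0`; the Green identity `A G = δ₀` and the symmetry of `A = (ω₂+2) − S − S⁻¹`). [folklore] -/
theorem thermalCov_kg_skew {ω₂ : ℝ} (hω : 0 < ω₂) (T : ℝ) (f g : TestFn) :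
    thermalCov ω₂ T ((-(ω₂ + 2)) • f.2 + Finsupp.mapDomain (fun x : ℤ => x + 1) f.2 +
        Finsupp.mapDomain (fun x : ℤ => x - 1) f.2, f.1) g =
      -thermalCov ω₂ T f ((-(ω₂ + 2)) • g.2 + Finsupp.mapDomain (fun x : ℤ => x + 1) g.2 +
        Finsupp.mapDomain (fun x : ℤ => x - 1) g.2, g.1) := by
  rw [thermalCov_kg_left hω, thermalCov_kg_right hω]
  ring

/-! ## Conjunct (c): `L` is multiplication by `−iω` on thermal waves -/

/-- **Conjunct (c) of stub KAlg**: `w_{Lf}(k) = −iω(k) w_f(k)` (`ω₂ > 0`): the `q`-slot of `w_{Lf}` is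
`(−(ω₂+2) + e^{ik} + e^{−ik}) f̂^p/ω = −ω f̂^p`, its `p`-slot is `−i f̂^q`. [folklore] -/
theorem thermalWave_kg {ω₂ : ℝ} (hω : 0 < ω₂) (T : ℝ) (f : TestFn) (k : 𝕋) :
    thermalWave ω₂ T ((-(ω₂ + 2)) • f.2 + Finsupp.mapDomain (fun x : ℤ => x + 1) f.2 +
        Finsupp.mapDomain (fun x : ℤ => x - 1) f.2, f.1) k =
      -Complex.I * (PinnedChainKinetic.dispersion ω₂ k : ℂ) * thermalWave ω₂ T f k := by
  unfold thermalWave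
  have hω' : (dispersion ω₂ k : ℂ) ≠ 0 :=
    Complex.ofReal_ne_zero.2 (PinnedChainKinetic.dispersion_ne_zero hω k)
  have hsqC : (dispersion ω₂ k : ℂ) ^ 2 = (ω₂ : ℂ) + 2 - 2 * (cosT k : ℂ) := by
    have h := dispersion_sq_eq hω.le k
    have h' := congrArg (fun r : ℝ => (r : ℂ)) h
    push_cast at h'
    exact h'
  have h2 := fourier_one_add_fourier_neg_one k
  have key : ∀ (x : ℤ) (a : ℝ),
      (((-(ω₂ + 2)) * a : ℝ) : ℂ) * fourier x k / (dispersion ω₂ k : ℂ) +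
        (a : ℂ) * fourier (x + 1) k / (dispersion ω₂ k : ℂ) +
        (a : ℂ) * fourier (x - 1) k / (dispersion ω₂ k : ℂ) =
        -(dispersion ω₂ k : ℂ) * ((a : ℂ) * fourier x k) := by
    intro x a
    rw [sub_eq_add_neg, fourier_add, fourier_add]
    calc (((-(ω₂ + 2)) * a : ℝ) : ℂ) * fourier x k / (dispersion ω₂ k : ℂ) +
          (a : ℂ) * (fourier x k * fourier 1 k) / (dispersion ω₂ k : ℂ) +
          (a : ℂ) * (fourier x k * fourier (-1) k) / (dispersion ω₂ k : ℂ)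
        = (a : ℂ) * fourier x k * (-((ω₂ : ℂ) + 2) + ((fourier 1 k : ℂ) + fourier (-1) k)) /
            (dispersion ω₂ k : ℂ) := by
          push_cast
          ring
      _ = (a : ℂ) * fourier x k * (-(dispersion ω₂ k : ℂ) ^ 2) / (dispersion ω₂ k : ℂ) := by
          rw [h2, hsqC]
          ring
      _ = -(dispersion ω₂ k : ℂ) * ((a : ℂ) * fourier x k) := by
          field_simp
  rw [sum_kgFst ω₂ f.2 (fun x a => (a : ℂ) * fourier x k / (dispersion ω₂ k : ℂ))
    (fun x => by simp) (fun x a b => by push_cast; ring)]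
  simp_rw [key]
  rw [← Finsupp.mul_sum]
  have hF : (f.1.sum fun x a => (a : ℂ) * fourier x k / (dispersion ω₂ k : ℂ)) =
      (f.1.sum fun x a => (a : ℂ) * fourier x k) * (dispersion ω₂ k : ℂ)⁻¹ := by
    simp only [div_eq_mul_inv, Finsupp.sum_mul]
  rw [hF]
  field_simp
  ring_nf
  rw [Complex.I_sq]
  ring

/-! ## Registered sub-goal: conjuncts (c) ∧ (d) of stub KAlg -/

/-- **Stub KAlg, conjuncts (c) ∧ (d)** (registered sub-goal `stub_harmonicPencilAlgebra_green` of
`stub_harmonicPencilAlgebra`): on thermal waves the lattice Klein–Gordon generator `L` is multiplication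
by `−iω(k)`, and the thermal covariance is `L`-skew. [folklore] -/
theorem stub_harmonicPencilAlgebra_green :
  (∀ (ω₂ T : ℝ), 0 < ω₂ → ∀ (f : TestFn) (k : 𝕋),
      thermalWave ω₂ T ((-(ω₂ + 2)) • f.2 + Finsupp.mapDomain (fun x : ℤ => x + 1) f.2 + Finsupp.mapDomain (fun x : ℤ => x - 1) f.2, f.1) k = -Complex.I * (PinnedChainKinetic.dispersion ω₂ k : ℂ) * thermalWave ω₂ T f k) ∧
  (∀ (ω₂ T : ℝ), 0 < ω₂ → ∀ f g : TestFn,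
      thermalCov ω₂ T ((-(ω₂ + 2)) • f.2 + Finsupp.mapDomain (fun x : ℤ => x + 1) f.2 + Finsupp.mapDomain (fun x : ℤ => x - 1) f.2, f.1) g = -thermalCov ω₂ T f ((-(ω₂ + 2)) • g.2 + Finsupp.mapDomain (fun x : ℤ => x + 1) g.2 + Finsupp.mapDomain (fun x : ℤ => x - 1) g.2, g.1)) :=
  ⟨fun _ T hω f k => thermalWave_kg hω T f k, fun _ T hω f g => thermalCov_kg_skew hω T f g⟩

end Summit.AtomisticToContinuum.FouriersLaw.Theorems.DrudeDissolution.GramPencilHarmonicChaos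

end
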